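import Summits.BirchSwinnertonDyer.Rank1Residual.X11a.MainConjecture
import HarnessLib

/-!
# Class X11a, surjective image: the equivalence `BSD(E,p) ⟺ Mazur's main conjecture at (E,p)` and
# the per-pair main-conjecture certificates (cell `b2b-bsdres`, unit `b2b-bsdres-x11a`, gen 13)

HONEST FRAMING (run/shared/lean/b2b/bsd-rank1-residual/, verbatim in every file): the goal of the
cell is to DELETE the COMBINATION-SHAPED residual classes of the Birch–Swinnerton-Dyer formula for
ALL analytic-rank `≤ 1` elliptic curves over `ℚ` — "full BSD formula for every rank `≤ 1` curve in
class `C`" assembled STRICTLY from published theorems — so that the rank-`≤ 1` remainder becomes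
exactly the CONSTRUCTION-SHAPED classes, which are TYPED (missing-input `Prop`s), NOT attempted.
This is not "finishing BSD". Research routes; NO CLAIM BEYOND STATED CLASSES. Theorems only (no
definition, no named fact); companion of `X11a/MainConjecture.lean` (the converse chain
`mazurMainConjectureAt_of_bsdp`: at a multiplicative `p ≥ 5` with surjective `ρ̄_{E,p}` and
`ord_{s=1}L(E,s) = 0`, `BSD(E,p)` ⟹ Mazur's main conjecture at `(E,p)`, from Kato's divisibility for
surjective image [Wuthrich 2014 Thm. 3 / Cor. 19, flag `Wu14-surj-attribution`], Stein–Wuthrich 2013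
Thm. 6.1, Greenberg–Stevens, `𝓛_p ≠ 0`, GZK, modularity) and of `X11a/Cells.lean` (the class
statement; typed input of the leaf = `X2.MazurMainConjectureAt`).

* `mazurMainConjectureAt_iff_bsdp`, `mazurMainConjectureAt_iff_missingLowerBoundAt`: at such a pair
  the main conjecture, Miller's `BSD(E,p)` and the lower bound `ord_p #Ш_an ≤ ord_p #Ш` coincide
  (⇒ is eisenstein-p2's `X2.bsdp_of_mazurMainConjectureAt_of_analyticRank_eq_zero` = x11a gen-8 glue).
  So on X11a's surjective leaf the typed missing input is EXACTLY Mazur's main conjecture at a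
  (ram)-free multiplicative prime — neither weaker nor stronger; class level:
  `forall_mazurMainConjectureAt_iff_forall_bsdp`.
* PER-PAIR MAIN-CONJECTURE CERTIFICATES from the published record:
  `mazurMainConjectureAt_of_shaAn_unit` (Wuthrich Prop. 21: every `r = 0`, `p ≥ 5`, `p ‖ N`,
  `ρ̄`-surjective pair with `p ∤ #Ш(E/ℚ)_an`, WITH OR WITHOUT (ram) — 613 of the 615 rank-`0`
  X11-type census pairs `N < 2·10⁴`), `mazurMainConjectureAt_of_kim` (Kim, Amer. J. Math. 148 (2026)
  Thm. 1.8 (6) + ONE unit Kurihara number: `10580l1@5`, `17640l1@5` — très ramifié, `#Ш_an = 25`, no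
  (ram) prime, i.e. OUTSIDE Skinner 2016 Thm. A — and 141 further pairs `N < 5·10⁵`, REPORT-g12).
* Consistency with the gen-2 typing (`X11RankZero.MissingInputAt` of `Typed/X11.lean` is exact on
  X11a: `missingInputAt_iff_bsdp`) and the lower-bound form `bsdp_iff_missingLowerBoundAt_of_surj`.

What this does NOT do: no class-level deletion (nothing in print reaches the main conjecture at a
très-ramifié (ram)-free multiplicative prime with `p ∣ #Ш_an`); nothing in rank `1`; nothing for a
non-surjective irreducible image.

References: [GreenbergLNM1716] §4 (PDF pp. 112–113), §5; [Wuthrich2014] Thm. 3, Cor. 19 (p. 399),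
Prop. 21 (p. 400); [SteinWuthrich2013] Thm. 6.1; [GreenbergStevens1993]; [Skinner2016PacificMC]
Thm. A, C; [Kim2022StructureSelmer] Thm. 1.9 (6); [Miller2011LMS] Def. 1.1.
-/

set_option autoImplicit false

noncomputable section

open scoped Classical MatrixGroups ModularForm

open CongruenceSubgroup WeierstrassCurve Literature.NumberTheory.EllipticCurves
  Literature.NumberTheory.EllipticCurves.ModularForms
  Literature.NumberTheory.EllipticCurves.Rank1Residual
  Literature.NumberTheory.EllipticCurves.Rank1Residual.Typed
  Literature.NumberTheory.EllipticCurves.Wuthrich2014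
  Literature.NumberTheory.EllipticCurves.SteinWuthrich2013

namespace Summit.BirchSwinnertonDyer.Rank1Residual.X11a

/-! ### The equivalences -/

/-- **At a multiplicative `p ≥ 5` with surjective `ρ̄_{E,p}` and `ord_{s=1}L(E,s) = 0`:
Mazur's main conjecture at `(E,p)` ⟺ `BSD(E,p)`** (⇒: eisenstein-p2 / x11a gen 8 glue
`X2.bsdp_of_mazurMainConjectureAt_of_analyticRank_eq_zero`, needing modularity with a newform
datum `hpar`; ⇐: `mazurMainConjectureAt_of_bsdp`). On X11a's surjective leaf the typed missing input
is therefore EXACT. [cite: GreenbergLNM1716, §4 (PDF pp. 112–113) and §5 (closing examples)]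
[cite: SteinWuthrich2013, Thm. 6.1 (p. 20)] [cite: Wuthrich2014, Thm. 3 (p. 382) and Cor. 19 proof (p. 399)] -/
theorem mazurMainConjectureAt_iff_bsdp
    (hKato : kato_charIdeal_dvd_multiplicative_of_surjective)
    (hJs : thm61_splitMultiplicative) (hJn : thm61_nonsplitMultiplicative)
    (hHs : exists_isSplitMultCanonical) (hHn : exists_isMultCanonical)
    (hGZK : rank_eq_analyticRank_of_analyticRank_le_one) (hmod : hasEntireLFunction_rat)
    (hpar : nonempty_modularParametrizationData)
    (W : WeierstrassCurve ℚ) [W.IsElliptic] [W.IsGloballyMinimal] (p : ℕ) [Fact p.Prime]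
    (hGS : greenberg_stevens (W := W) (p := p))
    (hp : 5 ≤ p) (hmult : W.HasMultiplicativeReductionAtPrime p)
    (hsurj : W.HasSurjectiveModNGaloisRep p) (hr : W.analyticRank = 0) :
    X2.MazurMainConjectureAt W p ↔ BSDp W p :=
  ⟨X2.bsdp_of_mazurMainConjectureAt_of_analyticRank_eq_zero hJs hJn hHs hHn hGZK hmod hpar W p hGS
      (by omega) hmult hr,
    mazurMainConjectureAt_of_bsdp hKato hJs hJn hHs hHn hGZK hmod W p hGS hp hmult hsurj hr⟩

/-- **The same with the typed LOWER bound on the right** (`ord_p #Ш_an ≤ ord_p #Ш`,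
`Typed.MissingLowerBoundAt`): at such a pair the three statements — main conjecture, `BSD(E,p)`,
lower bound — coincide (the upper bound half of `BSD(E,p)` comes with it).
[cite: Wuthrich2014, Prop. 21 (p. 400)] [cite: GreenbergLNM1716, §4 (PDF pp. 112–113)] -/
theorem mazurMainConjectureAt_iff_missingLowerBoundAt
    (hKato : kato_charIdeal_dvd_multiplicative_of_surjective)
    (hJs : thm61_splitMultiplicative) (hJn : thm61_nonsplitMultiplicative)
    (hHs : exists_isSplitMultCanonical) (hHn : exists_isMultCanonical)
    (hGZK : rank_eq_analyticRank_of_analyticRank_le_one) (hmod : hasEntireLFunction_rat)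
    (hpar : nonempty_modularParametrizationData)
    (W : WeierstrassCurve ℚ) [W.IsElliptic] [W.IsGloballyMinimal] (p : ℕ) [Fact p.Prime]
    (hGS : greenberg_stevens (W := W) (p := p))
    (hp : 5 ≤ p) (hmult : W.HasMultiplicativeReductionAtPrime p)
    (hsurj : W.HasSurjectiveModNGaloisRep p) (hr : W.analyticRank = 0) :
    X2.MazurMainConjectureAt W p ↔ MissingLowerBoundAt W p := by
  constructor
  · intro hMC
    haveI : Finite W.sha := (hGZK W (by rw [hr]; exact zero_le_one)).2
    exact (lower_and_upper_of_missingPPartAt W p (missingPPartAt_of_bsdp W p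
      (X2.bsdp_of_mazurMainConjectureAt_of_analyticRank_eq_zero hJs hJn hHs hHn hGZK hmod hpar W p hGS
        (by omega) hmult hr hMC))).1
  · exact mazurMainConjectureAt_of_missingLowerBoundAt hKato hJs hJn hHs hHn hGZK hmod W p hGS hp
      hmult hsurj hr

/-- **Class level, surjective image: "`BSD(E,p)` at every X11a pair with `p ≥ 5` and `ρ̄`
surjective" ⟺ "Mazur's main conjecture at every such pair"** (same facts). Neither side is in
print at the très-ramifié pairs with `p ∣ #Ш_an`; this says the missing object is EXACTLY the
(ram)-free cyclotomic main conjecture at `p ‖ N` in analytic rank `0`.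
[cite: GreenbergLNM1716, §4 (PDF pp. 112–113) and §5 (closing examples)]
[cite: Skinner2016PacificMC, Thm. A (§1) (hypothesis (iii) = (ram))] -/
theorem forall_mazurMainConjectureAt_iff_forall_bsdp
    (hKato : kato_charIdeal_dvd_multiplicative_of_surjective)
    (hJs : thm61_splitMultiplicative) (hJn : thm61_nonsplitMultiplicative)
    (hHs : exists_isSplitMultCanonical) (hHn : exists_isMultCanonical)
    (hGZK : rank_eq_analyticRank_of_analyticRank_le_one) (hmod : hasEntireLFunction_rat)
    (hpar : nonempty_modularParametrizationData)
    (hGS : ∀ (W : WeierstrassCurve ℚ) [W.IsElliptic] [W.IsGloballyMinimal] (p : ℕ) [Fact p.Prime],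
      greenberg_stevens (W := W) (p := p)) :
    (∀ (W : WeierstrassCurve ℚ) [W.IsElliptic] [W.IsGloballyMinimal] (p : ℕ) [Fact p.Prime],
      ClassX11a W p → 5 ≤ p → Surj W p → X2.MazurMainConjectureAt W p) ↔
    (∀ (W : WeierstrassCurve ℚ) [W.IsElliptic] [W.IsGloballyMinimal] (p : ℕ) [Fact p.Prime],
      ClassX11a W p → 5 ≤ p → Surj W p → BSDp W p) := by
  constructor
  · intro h W _ _ p _ hX hp hsurj
    exact (mazurMainConjectureAt_iff_bsdp hKato hJs hJn hHs hHn hGZK hmod hpar W p (hGS W p) hp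
      hX.2.2.1 hsurj hX.1).mp (h W p hX hp hsurj)
  · intro h W _ _ p _ hX hp hsurj
    exact (mazurMainConjectureAt_iff_bsdp hKato hJs hJn hHs hHn hGZK hmod hpar W p (hGS W p) hp
      hX.2.2.1 hsurj hX.1).mpr (h W p hX hp hsurj)

/-! ### Per-pair main-conjecture certificates from the published record -/

/-- **Mazur's main conjecture at every rank-`0`, `p ≥ 5`, `p ‖ N`, `ρ̄`-surjective pair with
`p ∤ #Ш(E/ℚ)_an` — WITHOUT (ram).** Wuthrich 2014 Prop. 21 (`hWu`) closes `BSD(E,p)` there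
(x11a gen 1 `Wuthrich2014.bsdp_of_L_one_ne_zero_of_padicValRat_shaAn_eq_zero`), and the converse
chain turns it into the main conjecture at the pair. Census: 613 of the 615 rank-`0` X11-type pairs
`N < 2·10⁴` at `p ≥ 5`; e.g. every multiplicative `p ≥ 5` of a rank-`0` curve with `#Ш_an = 1` and
surjective `ρ̄_{E,p}`. [cite: Wuthrich2014, Prop. 21 (p. 400) and Cor. 19 proof (p. 399)]
[cite: GreenbergLNM1716, §4 (PDF pp. 112–113) and §5 (closing examples)] -/
theorem mazurMainConjectureAt_of_shaAn_unit
    (hKato : kato_charIdeal_dvd_multiplicative_of_surjective) (hWu : sha_dvd_analyticSha)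
    (hJs : thm61_splitMultiplicative) (hJn : thm61_nonsplitMultiplicative)
    (hHs : exists_isSplitMultCanonical) (hHn : exists_isMultCanonical)
    (hGZK : rank_eq_analyticRank_of_analyticRank_le_one) (hmod : hasEntireLFunction_rat)
    (W : WeierstrassCurve ℚ) [W.IsElliptic] [W.IsGloballyMinimal] (p : ℕ) [Fact p.Prime]
    (hGS : greenberg_stevens (W := W) (p := p))
    (hp : 5 ≤ p) (hmult : W.HasMultiplicativeReductionAtPrime p)
    (hsurj : W.HasSurjectiveModNGaloisRep p) (hr : W.analyticRank = 0)
    (hunit : ∃ q : ℚ, shaAn W = (q : ℂ) ∧ padicValRat p q = 0) :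
    X2.MazurMainConjectureAt W p :=
  mazurMainConjectureAt_of_bsdp hKato hJs hJn hHs hHn hGZK hmod W p hGS hp hmult hsurj hr
    (Wuthrich2014.bsdp_of_L_one_ne_zero_of_padicValRat_shaAn_eq_zero hWu hGZK W p (by omega)
      ((W.analyticRank_eq_zero_iff_holds (hmod W)).1 hr)
      (WeierstrassCurve.HasMultiplicativeReduction.not_hasAdditiveReduction _ hmult) (Or.inr hsurj)
      hunit)

/-- **Mazur's main conjecture at `(E,p)` from ONE unit Kurihara number** (X11 ∧ `r = 0`, `p ≥ 5`,
`ρ̄` surjective, `p ∤ ∏c_ℓ·#E(ℚ)_tors`): Kim, Amer. J. Math. 148 (2026) Thm. 1.8 (6) (`hKim`) with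
the period transfer at `p ‖ N` (`hϖ`) closes `BSD(E,p)` (gen 12
`X11RankZero.bsdp_of_kim_of_kuriharaNumber_ne_zero`), and the converse chain gives the main
conjecture. Instances: `10580l1@5` (`δ̃_{251·281} ≡ 2`), `17640l1@5` (`δ̃_{101·131} ≡ 1`) — rank `0`,
`#Ш_an = 25`, très ramifié, NO (ram) prime: outside Skinner 2016 Thm. A — and 141 further pairs
`N < 5·10⁵` (REPORT-g12). [cite: Kim2022StructureSelmer, Thm. 1.9 (6) (PDF p. 8), Cor. 1.6]
[cite: GreenbergLNM1716, §4 (PDF pp. 112–113) and §5 (closing examples)] -/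
theorem mazurMainConjectureAt_of_kim
    (hKato : kato_charIdeal_dvd_multiplicative_of_surjective)
    (hKim : Kim2022_rankZero_padicValRat_sha_of_kuriharaNumber_ne_zero)
    (hϖ : realPeriodRat_eq_unit_mul_plusPeriod_of_multiplicative)
    (hJs : thm61_splitMultiplicative) (hJn : thm61_nonsplitMultiplicative)
    (hHs : exists_isSplitMultCanonical) (hHn : exists_isMultCanonical)
    (hGZK : rank_eq_analyticRank_of_analyticRank_le_one) (hmod : hasEntireLFunction_rat)
    (W : WeierstrassCurve ℚ) [W.IsElliptic] [W.IsGloballyMinimal] (p : ℕ) [Fact p.Prime]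
    (hGS : greenberg_stevens (W := W) (p := p))
    (hp : 5 ≤ p) (hr : W.analyticRank = 0) (hX : ClassX11 W p) (hsurj : Surj W p)
    (htam : ¬ p ∣ W.tamagawaProduct) (htors : ¬ p ∣ W.torsionOrder)
    {N : ℕ} [NeZero N] (f : CuspForm (Gamma0 N) 2) (hf : IsNewformOf W f)
    (n : ℕ) [NeZero n] (hn : Kato.IsKolyvaginProduct W p 1 n)
    (hcyc : ∀ (ℓ : ℕ) [Fact ℓ.Prime], ℓ ∣ n →
      Nat.card {P : ((WeierstrassCurve.integralModelInt W).map
          (Int.castRingHom (ZMod ℓ))).toAffine.Point // p • P = 0} ≤ p)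
    (ψ : (ℓ : ℕ) → (ZMod ℓ)ˣ →* Multiplicative (ZMod (p ^ 1)))
    (hψ : ∀ ℓ ∈ n.primeFactors, Function.Surjective (ψ ℓ))
    (hδ : kuriharaNumber f (p ^ 1) n ψ ≠ 0) : X2.MazurMainConjectureAt W p :=
  mazurMainConjectureAt_of_bsdp hKato hJs hJn hHs hHn hGZK hmod W p hGS hp hX.1 hsurj hr
    (X11RankZero.bsdp_of_kim_of_kuriharaNumber_ne_zero W p hKim hϖ hGZK hmod hp hr hX hsurj htam
      htors f hf n hn hcyc ψ hψ hδ)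

/-! ### Consistency with the gen-2 typing `X11RankZero.MissingInputAt` and the lower-bound form -/

/-- On X11a the gen-2 typed input (`X11RankZero.MissingInputAt W p`, `Typed/X11.lean`: the LOWER
bound if `ρ̄` is surjective, the whole `p`-part otherwise) gives `BSD(E,p)`
(`X11RankZero.bsdp_of_missingInputAt`; Wuthrich Prop. 21 `hWu`, GZK, modularity).
[cite: Wuthrich2014, Prop. 21 (p. 400)] [cite: Miller2011LMS, §1 and Def. 1.1] -/
theorem bsdp_of_missingInputAt (hWu : sha_dvd_analyticSha)
    (hGZK : rank_eq_analyticRank_of_analyticRank_le_one) (hmod : hasEntireLFunction_rat)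
    {W : WeierstrassCurve ℚ} [W.IsElliptic] [W.IsGloballyMinimal] {p : ℕ} [Fact p.Prime]
    (hX : ClassX11a W p) (hmiss : X11RankZero.MissingInputAt W p) : BSDp W p :=
  X11RankZero.bsdp_of_missingInputAt hWu hGZK hmod W p hX.2.1 hX.1 hX.toX11 hmiss

/-- Conversely `BSD(E,p)` gives the gen-2 typed input (finite `Ш` by GZK): so
`X11RankZero.MissingInputAt` is EXACT on X11a. [cite: Miller2011LMS, Def. 1.1] -/
theorem missingInputAt_of_bsdp (hGZK : rank_eq_analyticRank_of_analyticRank_le_one)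
    {W : WeierstrassCurve ℚ} [W.IsElliptic] [W.IsGloballyMinimal] {p : ℕ} [Fact p.Prime]
    (hX : ClassX11a W p) (h : BSDp W p) : X11RankZero.MissingInputAt W p := by
  haveI : Finite W.sha := (hGZK W (by rw [hX.1]; exact zero_le_one)).2
  exact X11RankZero.missingInputAt_of_missingPPartAt (missingPPartAt_of_bsdp W p h)

/-- On X11a: `X11RankZero.MissingInputAt W p ↔ BSDp W p` (Wuthrich Prop. 21, GZK, modularity).
[cite: Wuthrich2014, Prop. 21 (p. 400)] [cite: Miller2011LMS, Def. 1.1] -/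
theorem missingInputAt_iff_bsdp (hWu : sha_dvd_analyticSha)
    (hGZK : rank_eq_analyticRank_of_analyticRank_le_one) (hmod : hasEntireLFunction_rat)
    {W : WeierstrassCurve ℚ} [W.IsElliptic] [W.IsGloballyMinimal] {p : ℕ} [Fact p.Prime]
    (hX : ClassX11a W p) : X11RankZero.MissingInputAt W p ↔ BSDp W p :=
  ⟨bsdp_of_missingInputAt hWu hGZK hmod hX, missingInputAt_of_bsdp hGZK hX⟩

/-- **On the surjective part of X11a the missing input is the LOWER bound alone**:
`BSDp W p ↔ Typed.MissingLowerBoundAt W p` (`ord_p #Ш(E/ℚ)_an ≤ ord_p #Ш(E/ℚ)`), the upper bound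
being Wuthrich 2014 Prop. 21 (`hWu`; `Typed.bsdp_of_missingLowerBoundAt_of_wuthrich`).
[cite: Wuthrich2014, Prop. 21 (p. 400)] [cite: Miller2011LMS, Def. 1.1] -/
theorem bsdp_iff_missingLowerBoundAt_of_surj (hWu : sha_dvd_analyticSha)
    (hGZK : rank_eq_analyticRank_of_analyticRank_le_one) (hmod : hasEntireLFunction_rat)
    {W : WeierstrassCurve ℚ} [W.IsElliptic] [W.IsGloballyMinimal] {p : ℕ} [Fact p.Prime]
    (hX : ClassX11a W p) (hsurj : Surj W p) : BSDp W p ↔ MissingLowerBoundAt W p := by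
  constructor
  · intro h
    haveI : Finite W.sha := (hGZK W (by rw [hX.1]; exact zero_le_one)).2
    exact (lower_and_upper_of_missingPPartAt W p (missingPPartAt_of_bsdp W p h)).1
  · intro hlow
    exact bsdp_of_missingLowerBoundAt_of_wuthrich W p hWu hGZK hmod hX.2.1 hX.1
      (WeierstrassCurve.HasMultiplicativeReduction.not_hasAdditiveReduction _ hX.2.2.1)
      (Or.inr hsurj) hlow

end Summit.BirchSwinnertonDyer.Rank1Residual.X11a

end
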